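import Literature.Algebra.Homology.ExtDualityLadder
import HarnessLib

/-!
# Base cases of Tate's duality theorem (Milne ADT I Lemma 1.7 / Harari Lemma 16.19, formal part):
# `α²(P)` versus `inv`, `α¹(P)` when `H¹ = 0`, and the vanishing `Ext^{r+1}(P/m, C) = 0`

Topic `Algebra/Homology`; namespace `Literature.Algebra.Homology.ExtDuality`.  Theorems only, for
Mathlib's `Abelian.Ext` in any abelian category with `HasExt`; no definition, no named fact, no
instance, no `sorry`.  Sequel of `ExtDualityPairing` / `ExtDualityLadder` (`α^r = adjointMap inv`).

THE STATEMENTS IN PRINT.  Milne ADT I Lemma 1.7: for the "point" `P = ℤ` of a class formation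
`(G, C)` with `inv : H²(G, C) ≅ ℚ/ℤ`, `α²(G, ℤ) = inv_G` (bijective), `α¹(G, ℤ) : 0 → 0`
(`H¹(G, C) = 0`, `H¹(G, ℤ) = 0`), and for `ℤ/m` the maps are induced through `0 → ℤ → ℤ → ℤ/m → 0`;
proof of Thm 1.8: `Ext³_G(ℤ/mℤ, C) = 0` because `Ext³_G(ℤ, C) = 0` and `Ext²_G(ℤ, C)` is divisible.
Here, abstractly (`P C : 𝒞`, `inv : Ext²(P, C) →+ Q`, the hypothesis "`End(P) = ℤ · 𝟙`" in the form
`∀ f : P ⟶ P, ∃ n : ℤ, f = n • 𝟙`):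

* `adjointInjective_self_two` (`inv` injective ⟹ `α²(P)` injective), `adjointSurjective_self_two`
  (`inv` surjective and `End(P) = ℤ·𝟙` ⟹ `α²(P)` surjective), `adjointBijective_self_two`;
* `adjointBijective_of_forall_eq_zero` (both sides zero), `adjointBijective_self_one`
  (`Ext¹(P, C) = 0 = Ext¹(P, P)` ⟹ `α¹(P)` bijective);
* `precomp_mk₀_nsmul_id` (`(m • 𝟙)^* x = m • x`), `ext_eq_zero_X₃_of_precomp_surjective`
  (`f^*` onto and `Extʳ⁺¹(X₂, C) = 0` ⟹ `Extʳ⁺¹(X₃, C) = 0`), **`ext_succ_eq_zero_of_divisible`**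
  (for `0 → P —m→ P → P_m → 0`: `Extʳ(P, C)` `m`-divisible and `Extʳ⁺¹(P, C) = 0` ⟹ `Extʳ⁺¹(P_m, C) = 0`).

Written for Route A of the Poitou–Tate programme of crux `stmt-BirchSwinnertonDyer-19295` (cell
`bsd-schneider-ideate`, seat door-c4 gen 15).  HONEST FRAMING: homological algebra only.

## References
* J. S. Milne, *Arithmetic Duality Theorems* (2nd ed. 2006), I §1, Lemma 1.7 and the proof of
  Theorem 1.8 (p. 22: `Ext³_G(ℤ/mℤ, C) = 0`). [MilneADT2006]
* D. Harari, *Galois Cohomology and Class Field Theory*, Universitext (2020), §16.3, Lemma 16.19 –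
  Theorem 16.21. [Harari2020]
-/

noncomputable section

universe w' w v u

namespace Literature.Algebra.Homology

namespace ExtDuality

open CategoryTheory CategoryTheory.Abelian

variable {𝒞 : Type u} [Category.{v} 𝒞] [Abelian 𝒞] [HasExt.{w} 𝒞]
  {P C : 𝒞} {Q : Type w'} [AddCommGroup Q] (inv : Ext P C 2 →+ Q)

/-! ## §1 `α²(P)` is `inv` -/

/-- `α²(P)(x)(mk₀ 𝟙) = inv x`. [cite: MilneADT2006, I Lemma 1.7] -/
theorem adjointMap_self_two_apply_mk₀_id (h : 0 + 2 = 2) (x : Ext P C 2) :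
    adjointMap inv P h x (Ext.mk₀ (𝟙 P)) = inv x := by
  change inv ((Ext.mk₀ (𝟙 P)).comp x h) = inv x
  rw [Ext.mk₀_id_comp]

/-- **`inv` injective ⟹ `α²(P)` injective.** [cite: MilneADT2006, I Lemma 1.7] -/
theorem adjointInjective_self_two (h : 0 + 2 = 2) (hinv : Function.Injective inv) :
    AdjointInjective inv P h := by
  intro x x' hxx'
  apply hinv
  rw [← adjointMap_self_two_apply_mk₀_id inv h x, ← adjointMap_self_two_apply_mk₀_id inv h x', hxx']

/-- `mk₀ (n • f) = n • mk₀ f` (`ℤ`-multiples). [cite: Harari2020, §16.2 (16.4)] -/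
theorem mk₀_zsmul {X Y : 𝒞} (n : ℤ) (f : X ⟶ Y) : Ext.mk₀ (n • f) = n • Ext.mk₀ f := by
  rw [← Ext.addEquiv₀_symm_apply, ← Ext.addEquiv₀_symm_apply, map_zsmul]

/-- `mk₀ (m • f) = m • mk₀ f` (`ℕ`-multiples). [cite: Harari2020, §16.2 (16.4)] -/
theorem mk₀_nsmul {X Y : 𝒞} (m : ℕ) (f : X ⟶ Y) : Ext.mk₀ (m • f) = m • Ext.mk₀ f := by
  rw [← Ext.addEquiv₀_symm_apply, ← Ext.addEquiv₀_symm_apply, map_nsmul]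

/-- `(n • y) ∘ x = n • (y ∘ x)`. [cite: Harari2020, §16.2 (16.4)] -/
theorem zsmul_comp {X Y Z : 𝒞} {a b c : ℕ} (n : ℤ) (y : Ext X Y a) (x : Ext Y Z b) (h : a + b = c) :
    (n • y).comp x h = n • y.comp x h := by
  change (Ext.bilinearComp X Y Z a b c h (n • y)) x = n • (Ext.bilinearComp X Y Z a b c h y) x
  rw [map_zsmul, AddMonoidHom.zsmul_apply]

/-- `(m • y) ∘ x = m • (y ∘ x)`. [cite: Harari2020, §16.2 (16.4)] -/
theorem nsmul_comp {X Y Z : 𝒞} {a b c : ℕ} (m : ℕ) (y : Ext X Y a) (x : Ext Y Z b) (h : a + b = c) :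
    (m • y).comp x h = m • y.comp x h := by
  change (Ext.bilinearComp X Y Z a b c h (m • y)) x = m • (Ext.bilinearComp X Y Z a b c h y) x
  rw [map_nsmul, AddMonoidHom.nsmul_apply]

/-- **`inv` surjective and `End(P) = ℤ · 𝟙` ⟹ `α²(P)` surjective**: a functional `Φ` on
`Ext⁰(P, P) = ℤ · [𝟙]` is `α²(P)(x)` for any `x` with `inv x = Φ [𝟙]`. [cite: MilneADT2006, I Lemma 1.7] -/
theorem adjointSurjective_self_two (h : 0 + 2 = 2) (hinv : Function.Surjective inv)
    (hP : ∀ f : P ⟶ P, ∃ n : ℤ, f = n • 𝟙 P) : AdjointSurjective inv P h := by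
  intro Φ
  obtain ⟨x, hx⟩ := hinv (Φ (Ext.mk₀ (𝟙 P)))
  refine ⟨x, ?_⟩
  ext y
  obtain ⟨f, rfl⟩ := (Ext.mk₀_bijective P P).2 y
  obtain ⟨n, rfl⟩ := hP f
  change inv ((Ext.mk₀ (n • 𝟙 P)).comp x h) = Φ (Ext.mk₀ (n • 𝟙 P))
  rw [mk₀_zsmul, zsmul_comp, map_zsmul, map_zsmul, Ext.mk₀_id_comp, hx]

/-- **`α²(P)` is bijective when `inv` is bijective and `End(P) = ℤ · 𝟙`** (Milne: `α²(G, ℤ) = inv_G`).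
[cite: MilneADT2006, I Lemma 1.7][cite: Harari2020, §16.3 Lemma 16.19] -/
theorem adjointBijective_self_two (h : 0 + 2 = 2) (hinv : Function.Bijective inv)
    (hP : ∀ f : P ⟶ P, ∃ n : ℤ, f = n • 𝟙 P) : AdjointBijective inv P h :=
  ⟨adjointInjective_self_two inv h hinv.1, adjointSurjective_self_two inv h hinv.2 hP⟩

/-- Conversely `α²(P)` injective ⟹ `inv` injective. [cite: MilneADT2006, I Lemma 1.7] -/
theorem inv_injective_of_adjointInjective_self_two (h : 0 + 2 = 2) (hα : AdjointInjective inv P h)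
    (hP : ∀ f : P ⟶ P, ∃ n : ℤ, f = n • 𝟙 P) : Function.Injective inv := by
  intro x x' hxx'
  apply hα
  ext y
  obtain ⟨f, rfl⟩ := (Ext.mk₀_bijective P P).2 y
  obtain ⟨n, rfl⟩ := hP f
  change inv ((Ext.mk₀ (n • 𝟙 P)).comp x h) = inv ((Ext.mk₀ (n • 𝟙 P)).comp x' h)
  rw [mk₀_zsmul, zsmul_comp, zsmul_comp, map_zsmul, map_zsmul, Ext.mk₀_id_comp, Ext.mk₀_id_comp, hxx']

/-! ## §2 Both sides zero; `α¹(P)` -/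

/-- If `Extʳ(M, C) = 0` and `Extˢ(P, M) = 0` then `α^r(M)` is bijective (`0 → 0`).
[cite: MilneADT2006, I Lemma 1.7] -/
theorem adjointBijective_of_forall_eq_zero {M : 𝒞} {r s : ℕ} (h : s + r = 2)
    (hM : ∀ x : Ext M C r, x = 0) (hPM : ∀ y : Ext P M s, y = 0) : AdjointBijective inv M h := by
  refine ⟨fun x x' _ => (hM x).trans (hM x').symm, fun Φ => ⟨0, ?_⟩⟩
  rw [map_zero]
  ext y
  rw [hPM y, map_zero, map_zero]

/-- If `Extʳ(M, C) = 0` then `α^r(M)` is injective. [cite: MilneADT2006, I Lemma 1.7] -/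
theorem adjointInjective_of_forall_eq_zero {M : 𝒞} {r s : ℕ} (h : s + r = 2)
    (hM : ∀ x : Ext M C r, x = 0) : AdjointInjective inv M h :=
  fun x x' _ => (hM x).trans (hM x').symm

/-- If `Extˢ(P, M) = 0` then `α^r(M)` is surjective (its target is `0`). [cite: MilneADT2006, I Lemma 1.7] -/
theorem adjointSurjective_of_forall_eq_zero {M : 𝒞} {r s : ℕ} (h : s + r = 2)
    (hPM : ∀ y : Ext P M s, y = 0) : AdjointSurjective inv M h := fun Φ =>
  ⟨0, by rw [map_zero]; ext y; rw [hPM y, map_zero, map_zero]⟩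

/-- **`α¹(P)` is bijective when `Ext¹(P, C) = 0` and `Ext¹(P, P) = 0`** (Milne: `α¹(G, ℤ) : 0 → 0`,
from `H¹(G, C) = 0` and `H¹(G, ℤ) = 0`). [cite: MilneADT2006, I Lemma 1.7][cite: Harari2020, §16.3 Lemma 16.19] -/
theorem adjointBijective_self_one (h : 1 + 1 = 2) (h1C : ∀ x : Ext P C 1, x = 0)
    (h1P : ∀ y : Ext P P 1, y = 0) : AdjointBijective inv P h :=
  adjointBijective_of_forall_eq_zero inv h h1C h1P

/-! ## §3 `Extʳ⁺¹(P/m, C) = 0` from divisibility -/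

/-- `(m • 𝟙_X)^* x = m • x` on `Extʳ(X, C)`. [cite: MilneADT2006, I Theorem 1.8 (proof)] -/
theorem precomp_mk₀_nsmul_id {X : 𝒞} (m : ℕ) {r : ℕ} (x : Ext X C r) :
    (Ext.mk₀ (m • 𝟙 X)).comp x (zero_add r) = m • x := by
  rw [mk₀_nsmul, nsmul_comp, Ext.mk₀_id_comp]

/-- For a short exact `0 → X₁ —f→ X₂ → X₃ → 0`: if `f^* : Extʳ(X₂, C) → Extʳ(X₁, C)` is onto and
`Extʳ⁺¹(X₂, C) = 0`, then `Extʳ⁺¹(X₃, C) = 0`. [cite: MilneADT2006, I Theorem 1.8 (proof)] -/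
theorem ext_eq_zero_X₃_of_precomp_surjective {S : ShortComplex 𝒞} (hS : S.ShortExact) (C : 𝒞)
    {r r' : ℕ} (hr : 1 + r = r')
    (hf : Function.Surjective ((Ext.mk₀ S.f).precomp C (zero_add r)))
    (h₂ : ∀ x : Ext S.X₂ C r', x = 0) (x : Ext S.X₃ C r') : x = 0 := by
  obtain ⟨x₁, rfl⟩ := Ext.contravariant_sequence_exact₃ (hS := hS) (Y := C) x
    (h₂ ((Ext.mk₀ S.g).comp x (zero_add r'))) hr
  obtain ⟨x₂, rfl⟩ := hf x₁
  exact hS.extClass_comp_assoc x₂ (h := hr)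

/-- **`Extʳ⁺¹(P/m, C) = 0`**: for a short exact `0 → P —m•𝟙→ P —g→ P_m → 0`, if `Extʳ(P, C)` is
`m`-divisible and `Extʳ⁺¹(P, C) = 0` then `Extʳ⁺¹(P_m, C) = 0` (Milne: `Ext³_G(ℤ/mℤ, C) = 0` because
`Ext²_G(ℤ, C) ≅ ℚ/ℤ` is divisible and `Ext³_G(ℤ, C) = 0`). [cite: MilneADT2006, I Theorem 1.8 (proof)] -/
theorem ext_succ_eq_zero_of_divisible {Pm : 𝒞} (m : ℕ) (g : P ⟶ Pm) (w : (m • 𝟙 P) ≫ g = 0)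
    (hS : (ShortComplex.mk (m • 𝟙 P) g w).ShortExact) (C : 𝒞) {r r' : ℕ} (hr : 1 + r = r')
    (hdiv : ∀ x : Ext P C r, ∃ y : Ext P C r, x = m • y)
    (h₂ : ∀ x : Ext P C r', x = 0) (x : Ext Pm C r') : x = 0 := by
  refine ext_eq_zero_X₃_of_precomp_surjective hS C hr (fun x₁ => ?_) h₂ x
  obtain ⟨y, rfl⟩ := hdiv x₁
  exact ⟨y, precomp_mk₀_nsmul_id m y⟩

/-- In all higher degrees: `Extʳ(P, C) = 0 = Extʳ⁺¹(P, C)` ⟹ `Extʳ⁺¹(P_m, C) = 0` (Milne: both sides of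
`α^r` vanish for `r ≥ 4`). [cite: MilneADT2006, I Lemma 1.9] -/
theorem ext_succ_eq_zero_of_eq_zero {Pm : 𝒞} (m : ℕ) (g : P ⟶ Pm) (w : (m • 𝟙 P) ≫ g = 0)
    (hS : (ShortComplex.mk (m • 𝟙 P) g w).ShortExact) (C : 𝒞) {r r' : ℕ} (hr : 1 + r = r')
    (h₁ : ∀ x : Ext P C r, x = 0) (h₂ : ∀ x : Ext P C r', x = 0) (x : Ext Pm C r') : x = 0 :=
  ext_eq_zero_of_ladder₃ hS C hr h₁ h₂ x

end ExtDuality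

end Literature.Algebra.Homology
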